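import Summits.Ventures.Crystal3D.Theorems.StickyWulffConstantTextureLiminfTexShadowBilayerFrameAxis
import Summits.Ventures.Crystal3D.Theorems.StickyWulffConstantTextureLiminfTexShadowCoaxialCharge
import Summits.Ventures.Crystal3D.Theorems.StickyWulffConstantTextureLiminfTexShadowZeroTable
import HarnessLib

/-!
# T-F2, the SAME-FRAME family of faulted plate pairs: charge cap `½·sin∠(L e₃, e₃)`, and the basal sub-case closed (zero table)

HONEST FRAMING. Venture `Summits/Ventures/Crystal3D` (cell `crystal3d-full`); helper for lane T's debt T-F2 = `stub_famFaulted`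
(TexShadow v7, crux `TextureLiminfV5` stmt-Ventures-23912; owner 19481-p1 per cf-p1 DECISION (lxxiii)).  Census-free, standard
axioms; rung credit only; F-C1 not moved.  Sizing memo HOME/wall-19481-p1/T-F2-n3.md: a faulted plate is never an F-U instance;
what survives of the planner's «θ = 0» intuition is exactly the BASAL sub-case below.  The SAME-FRAME family = two Barlow plates
presented with ONE frame `L` (any origins `s₁, s₂`, any Hägg words `σ₁, σ₂` — hcp|fcc, hcp|hcp, lamella|twin, …: the co-Barlow
family of axis `L e₃`); by `sharedAxis_bilayerFrames_of_frame` (…TexShadowBilayerFrameAxis) all facing bilayer-frame pairs share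
the axis `L e₃`, so:

* `frames_equal_or_coaxial_of_sameFrame` — the `hax` producer for faulted plates (wulff-p2's `frames_equal_or_coaxial_of_sharedAxis`
  needed `BothFcc`): every facing pair is EQUAL or co-axial with all shared axes `m'` at `√(1−⟪m',e₃⟫²) ≤ √(1−⟪L e₃,e₃⟫²)`;
* **`tsum_charge_le_of_sameFrame`** — every admissible table charges the unit slice at most `½·√(1−⟪L e₃,e₃⟫²)·πρ²`
  (the wholesale cap; the per-strip refinement «only mismatched strips are charged» is memo (L1), not here);
* `charges_zero_of_sameFrame_basal` — if the shared axis is the wall normal (`⟪L e₃, e₃⟫² = 1`) every admissible table VANISHES;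
* **`bilayerWallAt_of_sameFrame_basal`** — hence the wall-cell inequality for that pair at `((3456 + 1152(R₀+1))/2, R₀)`, `R₀ ≥ 3`,
  faulted or not: the basal same-frame cells of `stub_famFaulted` are CLOSED (by the zero table, `bilayerWallAt_of_charges_zero`).
WHAT THIS IS NOT: not the inclined same-frame cells (that is F_layer, memo §3); not the mixed-frame coincidence classes; F-C1 not moved.
-/

noncomputable section

open scoped BigOperators InnerProductSpace ENNReal
open MeasureTheory

namespace Summit.Ventures.Crystal3D.Theorems

open Summit.Ventures.Crystal3D
open Literature.MathematicalPhysics.StatisticalMechanics (IsHaggSeq)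
open Summit.Ventures.Crystal3D.Cruxes.TextureLiminf.TexShadow (E3 e₃ fccRef laySlab SharedAxis CoAx BilayerFramesAt
  BilayerChargeAdmissible BilayerWallAt)

/-- **The `hax` producer for a same-frame pair of Barlow plates (any Hägg words).**  Every facing pair of bilayer frames is
equal, or co-axial with all its shared axes `m'` satisfying `√(1 − ⟪m′, e₃⟫²) ≤ √(1 − ⟪L e₃, e₃⟫²)` (indeed `m' = ±L e₃`). -/
theorem frames_equal_or_coaxial_of_sameFrame {σ₁ σ₂ : ℤ → ℤ} (hσ₁ : IsHaggSeq σ₁) (hσ₂ : IsHaggSeq σ₂)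
    {L : E3 ≃ₗᵢ[ℝ] E3} {s₁ s₂ : E3} {A₁ A₂ : ℤ → (E3 ≃ₗᵢ[ℝ] E3)} {u₁ u₂ : ℤ → E3}
    (hfr₁ : BilayerFramesAt L s₁ σ₁ A₁ u₁) (hfr₂ : BilayerFramesAt L s₂ σ₂ A₂ u₂) :
    ∀ i j : ℤ, A₁ i '' fccRef = A₂ j '' fccRef ∨
      (CoAx (A₁ i) (A₂ j) ∧ ∀ m' : E3, SharedAxis m' (A₁ i) (A₂ j) →
        Real.sqrt (1 - ⟪m', e₃⟫_ℝ ^ 2) ≤ Real.sqrt (1 - ⟪L e₃, e₃⟫_ℝ ^ 2)) := by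
  intro i j
  by_cases heq : A₁ i '' fccRef = A₂ j '' fccRef
  · exact Or.inl heq
  · right
    have hm := sharedAxis_bilayerFrames_of_frame hσ₁ hσ₂ hfr₁ hfr₂ i j
    refine ⟨⟨L e₃, hm⟩, fun m' hm' => ?_⟩
    obtain ⟨L₀, r₁, r₂, τ, τ', hτ, hτ', hLe, hc₁, hc₂⟩ := hm
    obtain ⟨L', r₁', r₂', κ, κ', hκ, hκ', hLe', hc₁', hc₂'⟩ := hm'
    have hax := coaxial_axis_eq_or_eq_neg (A := A₁ i) (B := A₂ j) (m := L e₃) (m' := m')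
      ⟨L₀, r₁, r₂, τ, τ', hτ, hτ', hLe, hc₁, hc₂⟩ ⟨L', r₁', r₂', κ, κ', hκ, hκ', hLe', hc₁', hc₂'⟩ heq
    rcases hax with rfl | rfl
    · exact le_rfl
    · rw [inner_neg_left, neg_sq]

/-- **The wholesale charge cap for a same-frame pair**: every admissible table charges the unit slice of radius `ρ` at most
`½·√(1 − ⟪L e₃, e₃⟫²)·πρ²`. -/
theorem tsum_charge_le_of_sameFrame {σ₁ σ₂ : ℤ → ℤ} (hσ₁ : IsHaggSeq σ₁) (hσ₂ : IsHaggSeq σ₂)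
    {L : E3 ≃ₗᵢ[ℝ] E3} {s₁ s₂ : E3} {A₁ A₂ : ℤ → (E3 ≃ₗᵢ[ℝ] E3)} {u₁ u₂ : ℤ → E3}
    (hfr₁ : BilayerFramesAt L s₁ σ₁ A₁ u₁) (hfr₂ : BilayerFramesAt L s₂ σ₂ A₂ u₂)
    {c : ℤ → ℤ → ℝ} {m : ℤ → ℤ → E3} (hadm : BilayerChargeAdmissible A₁ A₂ c m) {ρ : ℝ} (hρ : 0 ≤ ρ) :
    ∑' ij : ℤ × ℤ, c ij.1 ij.2 * (volume (wallSlice ρ ∩ laySlab L s₁ ij.1 ∩ laySlab L s₂ ij.2)).toReal ≤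
      1 / 2 * Real.sqrt (1 - ⟪L e₃, e₃⟫_ℝ ^ 2) * (Real.pi * ρ ^ 2) :=
  tsum_charge_le_half_sin L L s₁ s₂ hadm (Real.sqrt_nonneg _) (frames_equal_or_coaxial_of_sameFrame hσ₁ hσ₂ hfr₁ hfr₂) hρ

/-- **Basal same-frame pairs: every admissible table vanishes.**  If the shared axis is the wall normal (`⟪L e₃, e₃⟫² = 1`, the
plates' close-packed layers parallel to the wall) then `c ≡ 0`. -/
theorem charges_zero_of_sameFrame_basal {σ₁ σ₂ : ℤ → ℤ} (hσ₁ : IsHaggSeq σ₁) (hσ₂ : IsHaggSeq σ₂)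
    {L : E3 ≃ₗᵢ[ℝ] E3} {s₁ s₂ : E3} {A₁ A₂ : ℤ → (E3 ≃ₗᵢ[ℝ] E3)} {u₁ u₂ : ℤ → E3}
    (hfr₁ : BilayerFramesAt L s₁ σ₁ A₁ u₁) (hfr₂ : BilayerFramesAt L s₂ σ₂ A₂ u₂)
    {c : ℤ → ℤ → ℝ} {m : ℤ → ℤ → E3} (hadm : BilayerChargeAdmissible A₁ A₂ c m)
    (hbasal : ⟪L e₃, e₃⟫_ℝ ^ 2 = 1) : ∀ i j : ℤ, c i j = 0 := by
  intro i j
  have hcap := cap_of_admissible hadm (Real.sqrt_nonneg _) (frames_equal_or_coaxial_of_sameFrame hσ₁ hσ₂ hfr₁ hfr₂) i j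
  rw [hbasal, sub_self, Real.sqrt_zero, mul_zero] at hcap
  exact le_antisymm hcap (hadm.1 i j)

/-- **T-F2, basal same-frame sub-case CLOSED**: two Barlow plates (ANY Hägg words) presented with one frame `L` whose axis is the
wall normal satisfy the wall-cell inequality for every admissible table, at `((3456 + 1152(R₀+1))/2, R₀)`, `R₀ ≥ 3`. -/
theorem bilayerWallAt_of_sameFrame_basal {σ₁ σ₂ : ℤ → ℤ} (hσ₁ : IsHaggSeq σ₁) (hσ₂ : IsHaggSeq σ₂)
    {L : E3 ≃ₗᵢ[ℝ] E3} {s₁ s₂ : E3} {A₁ A₂ : ℤ → (E3 ≃ₗᵢ[ℝ] E3)} {u₁ u₂ : ℤ → E3}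
    (hfr₁ : BilayerFramesAt L s₁ σ₁ A₁ u₁) (hfr₂ : BilayerFramesAt L s₂ σ₂ A₂ u₂)
    {c : ℤ → ℤ → ℝ} {m : ℤ → ℤ → E3} (hadm : BilayerChargeAdmissible A₁ A₂ c m)
    (hbasal : ⟪L e₃, e₃⟫_ℝ ^ 2 = 1) (R₀ : ℝ) (hR₀ : 3 ≤ R₀) :
    BilayerWallAt ((3456 + 1152 * (R₀ + 1)) / 2) R₀ σ₁ σ₂ L L s₁ s₂ c :=
  bilayerWallAt_of_charges_zero hσ₁ hσ₂ L L s₁ s₂ R₀ hR₀ (charges_zero_of_sameFrame_basal hσ₁ hσ₂ hfr₁ hfr₂ hadm hbasal)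

/-! ### Presentation-robust form: the twin family of one frame `P` (appended 19481-p1 g14)

The same conclusions when the two plates are presented with DIFFERENT frames but every bilayer lattice of either plate is
`P '' Λ₀` or its basal twin `(basalMirror ≫ P) '' Λ₀` (e.g. an fcc plate presented along another of its `{111}` axes facing a
faulted plate of frame `P`; or the second plate presented with `P ∘ g`, `g` a hexagonal symmetry). -/

open Literature.MathematicalPhysics.StatisticalMechanics (barlowStacking constHagg basalMirror)

/-- **The `hax` producer for the twin family of `P`.**  If every bilayer lattice of both plates is `P '' Λ₀` or `(basalMirror ≫ P) '' Λ₀`,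
every facing pair is equal, or co-axial with all its shared axes `m'` at `√(1 − ⟪m′, e₃⟫²) ≤ √(1 − ⟪P e₃, e₃⟫²)`. -/
theorem frames_equal_or_coaxial_of_twinFamily {P : E3 ≃ₗᵢ[ℝ] E3} {A₁ A₂ : ℤ → (E3 ≃ₗᵢ[ℝ] E3)}
    (h₁ : ∀ i, A₁ i '' fccRef = P '' fccRef ∨ A₁ i '' fccRef = (basalMirror.trans P) '' fccRef)
    (h₂ : ∀ j, A₂ j '' fccRef = P '' fccRef ∨ A₂ j '' fccRef = (basalMirror.trans P) '' fccRef) :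
    ∀ i j : ℤ, A₁ i '' fccRef = A₂ j '' fccRef ∨
      (CoAx (A₁ i) (A₂ j) ∧ ∀ m' : E3, SharedAxis m' (A₁ i) (A₂ j) →
        Real.sqrt (1 - ⟪m', e₃⟫_ℝ ^ 2) ≤ Real.sqrt (1 - ⟪P e₃, e₃⟫_ℝ ^ 2)) := by
  -- every member of the twin family is `P`-framed through the origin
  have hfr : ∀ {A : E3 ≃ₗᵢ[ℝ] E3}, (A '' fccRef = P '' fccRef ∨ A '' fccRef = (basalMirror.trans P) '' fccRef) →
      ∃ τ : ℤ → ℤ, IsHaggSeq τ ∧ A '' fccRef ⊆ (fun p => P p + (0 : E3)) '' barlowStacking 1 (Real.sqrt (2 / 3)) τ := by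
    intro A hA
    rcases hA with h | h
    · exact ⟨constHagg, fun _ => Or.inl rfl, by rw [h, image_fccRef_eq_frameStacking]⟩
    · exact ⟨fun _ => -1, fun _ => Or.inr rfl, by rw [h, image_basalTwin_fccRef_eq_frameStacking]⟩
  intro i j
  by_cases heq : A₁ i '' fccRef = A₂ j '' fccRef
  · exact Or.inl heq
  · right
    obtain ⟨τ, hτ, hc₁⟩ := hfr (h₁ i)
    obtain ⟨τ', hτ', hc₂⟩ := hfr (h₂ j)
    have hm : SharedAxis (P e₃) (A₁ i) (A₂ j) := ⟨P, 0, 0, τ, τ', hτ, hτ', rfl, hc₁, hc₂⟩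
    refine ⟨⟨P e₃, hm⟩, fun m' hm' => ?_⟩
    obtain ⟨L', r₁', r₂', κ, κ', hκ, hκ', hLe', hc₁', hc₂'⟩ := hm'
    have hax := coaxial_axis_eq_or_eq_neg (A := A₁ i) (B := A₂ j) (m := P e₃) (m' := m')
      ⟨P, 0, 0, τ, τ', hτ, hτ', rfl, hc₁, hc₂⟩ ⟨L', r₁', r₂', κ, κ', hκ, hκ', hLe', hc₁', hc₂'⟩ heq
    rcases hax with rfl | rfl
    · exact le_rfl
    · rw [inner_neg_left, neg_sq]

/-- **Charge cap for the twin family** (any two presentations `(L₁,s₁)`, `(L₂,s₂)` of the slab partitions): every admissible table on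
bilayer frames from the twin family of `P` charges the unit slice at most `½·√(1 − ⟪P e₃, e₃⟫²)·πρ²`. -/
theorem tsum_charge_le_of_twinFamily (L₁ L₂ : E3 ≃ₗᵢ[ℝ] E3) (s₁ s₂ : E3) {P : E3 ≃ₗᵢ[ℝ] E3} {A₁ A₂ : ℤ → (E3 ≃ₗᵢ[ℝ] E3)}
    (h₁ : ∀ i, A₁ i '' fccRef = P '' fccRef ∨ A₁ i '' fccRef = (basalMirror.trans P) '' fccRef)
    (h₂ : ∀ j, A₂ j '' fccRef = P '' fccRef ∨ A₂ j '' fccRef = (basalMirror.trans P) '' fccRef)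
    {c : ℤ → ℤ → ℝ} {m : ℤ → ℤ → E3} (hadm : BilayerChargeAdmissible A₁ A₂ c m) {ρ : ℝ} (hρ : 0 ≤ ρ) :
    ∑' ij : ℤ × ℤ, c ij.1 ij.2 * (volume (wallSlice ρ ∩ laySlab L₁ s₁ ij.1 ∩ laySlab L₂ s₂ ij.2)).toReal ≤
      1 / 2 * Real.sqrt (1 - ⟪P e₃, e₃⟫_ℝ ^ 2) * (Real.pi * ρ ^ 2) :=
  tsum_charge_le_half_sin L₁ L₂ s₁ s₂ hadm (Real.sqrt_nonneg _) (frames_equal_or_coaxial_of_twinFamily h₁ h₂) hρ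

/-- **Basal twin family: every admissible table vanishes** (`⟪P e₃, e₃⟫² = 1`), hence the wall-cell inequality by the zero table for ANY
presentations and Hägg words of the two plates. -/
theorem bilayerWallAt_of_twinFamily_basal {σ₁ σ₂ : ℤ → ℤ} (hσ₁ : IsHaggSeq σ₁) (hσ₂ : IsHaggSeq σ₂)
    (L₁ L₂ : E3 ≃ₗᵢ[ℝ] E3) (s₁ s₂ : E3) {P : E3 ≃ₗᵢ[ℝ] E3} {A₁ A₂ : ℤ → (E3 ≃ₗᵢ[ℝ] E3)}
    (h₁ : ∀ i, A₁ i '' fccRef = P '' fccRef ∨ A₁ i '' fccRef = (basalMirror.trans P) '' fccRef)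
    (h₂ : ∀ j, A₂ j '' fccRef = P '' fccRef ∨ A₂ j '' fccRef = (basalMirror.trans P) '' fccRef)
    {c : ℤ → ℤ → ℝ} {m : ℤ → ℤ → E3} (hadm : BilayerChargeAdmissible A₁ A₂ c m)
    (hbasal : ⟪P e₃, e₃⟫_ℝ ^ 2 = 1) (R₀ : ℝ) (hR₀ : 3 ≤ R₀) :
    BilayerWallAt ((3456 + 1152 * (R₀ + 1)) / 2) R₀ σ₁ σ₂ L₁ L₂ s₁ s₂ c := by
  refine bilayerWallAt_of_charges_zero hσ₁ hσ₂ L₁ L₂ s₁ s₂ R₀ hR₀ fun i j => ?_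
  have hcap := cap_of_admissible hadm (Real.sqrt_nonneg _) (frames_equal_or_coaxial_of_twinFamily h₁ h₂) i j
  rw [hbasal, sub_self, Real.sqrt_zero, mul_zero] at hcap
  exact le_antisymm hcap (hadm.1 i j)

end Summit.Ventures.Crystal3D.Theorems

end
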